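import Mathlib
import HarnessLib
import Summits.HubbardSuperconductivity.HubbardSuperconductivity.Theorems.KLProgrammeThinLevelSetCubePacking

/-!
# Route `KLProgramme` — K3 engine (stmt-HubbardSuperconductivity-20437), stub (b) (ℓ)/(I2)–(I3), located item «ABS-UMK-COUNT» / «UV-REMEASURE-COUNT»:
# lattice points in thin level sets, part 2 — the VOLUME of a level window of a radially strongly growing function, and the combined grid count

Cell gate-hubbard-kl, seat p4 g14 (pen (R133)(ii)).  Sequel of `…ThinLevelSetCubePacking`:

* `volume_levelWindow_le` — the VOLUME of a level window `{x ∈ D : β − δ < F x ≤ β + δ}` of a function growing STRONGLY ALONG RAYS from a point `x⋆ ∈ D`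
  (`F(x⋆ + t(x − x⋆)) ≤ F x − (c/2)(1 − t²)‖x − x⋆‖²`, `t ∈ [0,1]`; so `x⋆` is its minimiser) and at most quadratically (`F x − F x⋆ ≤ (A/2)‖x − x⋆‖²`), `D` convex
  in `closedBall x⋆ R`, is at most `(2√(12dAδ)/c)^d + (4dAδ/c)·(2√(2/c))^d·(R√(A/2))^{d−2}` — `O(δ·R^{d−2})`, the area of a thin annulus — by a HOMOTHETY
  argument (the window shrunk by `t = √(1 − 2Aδ/(cs))` about `x⋆` falls into the sublevel set below the window, disjointly from that set's own shrinking;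
  Lebesgue measure scales by `t^d`): no coarea formula, no polar coordinates, any dimension `d ≥ 2`;
* `card_mul_pow_le_of_levelWindow` — the three steps combined: an `h`-separated set of points of `D` in the window `|F − β| ≤ δ` has `card · h^d ≤` the volume
  bound at half-width `2δ + (L+1)h` — `O((δ + h)R^{d−2}/h^d)` points, a full factor `h/R` below the box count when `δ ≍ h` (the «one more determined leg» of the
  sector-counting lemmas on the corner bundles, TIGHT-RELCOUNT-LAW §3(B)).

Everything is PROVED; no definitions, no named facts; generic real analysis — nothing about the model or superconductivity is asserted. [folklore]
-/

noncomputable section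

open Real Set MeasureTheory Metric
open scoped ENNReal

namespace Summit.HubbardSuperconductivity.HubbardSuperconductivity.Theorems.ThinLevelSet

set_option linter.dupNamespace false -- summit = problem name (single-conjunct summit), D-0017

variable {ι : Type*} [Fintype ι]

/-! ## §3 The volume of a level window of a radially strongly growing function -/

set_option maxHeartbeats 400000 in -- one long two-case measure-theoretic proof (homothety + cube bounds); 200k is marginal
/-- **Volume of a level window of a radially strongly growing function.**  Let `D ⊆ closedBall x⋆ R` be convex and measurable in `ι → ℝ` (sup norm,
`d = |ι| ≥ 2`), `F` measurable, growing strongly along rays from `x⋆ ∈ D` (so `x⋆` is its minimiser on `D`)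
(`F(x⋆ + t(x − x⋆)) ≤ F x − (c/2)(1 − t²)‖x − x⋆‖²` for `t ∈ [0,1]`) and at most quadratically (`F x − F x⋆ ≤ (A/2)‖x − x⋆‖²`), `0 < c ≤ A`.  Then for
`δ > 0` and every level `β`:
`vol {x ∈ D : β − δ < F x ≤ β + δ} ≤ (2√(12dAδ)/c)^d + (4dAδ/c)·(2√(2/c))^d·(R√(A/2))^{d−2}`.
Proof: if `s := β − δ − F x⋆ < 4dAδ/c` the window lies in the cube of half-side `√(12dAδ)/c`; otherwise, with `θ := 2Aδ/(cs)` and `t := √(1−θ)`, the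
homothety of ratio `t` about `x⋆` maps the window INTO the sublevel set `K := {F ≤ β − δ}` (points of the window are at distance `> √(2s/A)` from `x⋆`),
disjointly from the image of `K` itself (which also lies in `K`), so `t^d·(vol W + vol K) ≤ vol K`, `vol W ≤ (t^{−d} − 1)·vol K ≤ 2dθ·vol K`, and
`K ⊆ closedBall x⋆ √(2s/c)`. [folklore] -/
theorem volume_levelWindow_le {D : Set (ι → ℝ)} (hDc : Convex ℝ D) (hDm : MeasurableSet D)
    {F : (ι → ℝ) → ℝ} (hFm : Measurable F) {xs : ι → ℝ} (hxs : xs ∈ D)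
    {c A R : ℝ} (hc : 0 < c) (hcA : c ≤ A) (hR : 0 ≤ R) (hDR : D ⊆ Metric.closedBall xs R) (hd : 2 ≤ Fintype.card ι)
    (hgrow : ∀ x ∈ D, ∀ t : ℝ, 0 ≤ t → t ≤ 1 → F (AffineMap.homothety xs t x) ≤ F x - c / 2 * (1 - t ^ 2) * ‖x - xs‖ ^ 2)
    (hup : ∀ x ∈ D, F x - F xs ≤ A / 2 * ‖x - xs‖ ^ 2)
    (β δ : ℝ) (hδ : 0 < δ) :
    volume {x ∈ D | β - δ < F x ∧ F x ≤ β + δ} ≤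
      ENNReal.ofReal ((2 * Real.sqrt (12 * Fintype.card ι * A * δ) / c) ^ Fintype.card ι +
        (4 * Fintype.card ι * A * δ / c) * (2 * Real.sqrt (2 / c)) ^ Fintype.card ι * (R * Real.sqrt (A / 2)) ^ (Fintype.card ι - 2)) := by
  set d := Fintype.card ι with hd_def
  have hd1 : (1 : ℝ) ≤ d := by exact_mod_cast (show 1 ≤ d by omega)
  have hA : 0 < A := hc.trans_le hcA
  set m := F xs with hm
  set s := β - δ - m with hs
  set W := {x ∈ D | β - δ < F x ∧ F x ≤ β + δ} with hW
  -- both terms of the bound are nonnegative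
  have hT1 : 0 ≤ (2 * Real.sqrt (12 * d * A * δ) / c) ^ d := by positivity
  have hT2 : 0 ≤ (4 * d * A * δ / c) * (2 * Real.sqrt (2 / c)) ^ d * (R * Real.sqrt (A / 2)) ^ (d - 2) := by positivity
  -- distance control from the growth hypothesis at `t = 0`: `F x − m ≥ (c/2)‖x − x⋆‖²`
  have hlow : ∀ x ∈ D, c / 2 * ‖x - xs‖ ^ 2 ≤ F x - m := by
    intro x hx
    have h := hgrow x hx 0 le_rfl zero_le_one
    have e : AffineMap.homothety xs (0 : ℝ) x = xs := by
      rw [homothety_eq_add_smul, zero_smul, add_zero]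
    rw [e] at h
    norm_num at h
    linarith
  -- a sublevel set `{x ∈ D : F x − m ≤ u}` lies in the cube of half-side `√(2u/c)`
  have hcube : ∀ u : ℝ, 0 ≤ u → {x ∈ D | F x - m ≤ u} ⊆ Metric.closedBall xs (Real.sqrt (2 * u / c)) := by
    intro u _ x ⟨hxD, hxu⟩
    rw [mem_closedBall, dist_eq_norm]
    have h1 : ‖x - xs‖ ^ 2 ≤ 2 * u / c := by
      rw [le_div_iff₀ hc]; nlinarith [hlow x hxD]
    calc ‖x - xs‖ = Real.sqrt (‖x - xs‖ ^ 2) := (Real.sqrt_sq (norm_nonneg _)).symm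
      _ ≤ Real.sqrt (2 * u / c) := Real.sqrt_le_sqrt h1
  have hvolcube : ∀ u : ℝ, 0 ≤ u → volume {x ∈ D | F x - m ≤ u} ≤ ENNReal.ofReal ((2 * Real.sqrt (2 * u / c)) ^ d) := by
    intro u hu
    calc volume {x ∈ D | F x - m ≤ u} ≤ volume (Metric.closedBall xs (Real.sqrt (2 * u / c))) := measure_mono (hcube u hu)
      _ = ENNReal.ofReal ((2 * Real.sqrt (2 * u / c)) ^ d) := Real.volume_pi_closedBall xs (Real.sqrt_nonneg _)
  rcases lt_or_ge s (4 * d * A * δ / c) with hsmall | hsmall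
  · -- CASE 1: the window is near the minimum: `W ⊆ {F − m ≤ 6dAδ/c}`, a cube of half-side `√(12dAδ)/c`
    have hdA : 1 ≤ d * A / c := by
      rw [le_div_iff₀ hc]
      calc (1 : ℝ) * c = 1 * c := rfl
        _ ≤ d * A := mul_le_mul hd1 hcA hc.le (by linarith)
    have hsub : W ⊆ {x ∈ D | F x - m ≤ 6 * d * A * δ / c} := by
      intro x ⟨hxD, _, hx2⟩
      refine ⟨hxD, ?_⟩
      have h1 : F x - m ≤ s + 2 * δ := by rw [hs]; linarith
      have h2 : 2 * δ ≤ 2 * d * A * δ / c := by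
        have h3 : 2 * δ * 1 ≤ 2 * δ * (d * A / c) := mul_le_mul_of_nonneg_left hdA (by positivity)
        have e : 2 * δ * (d * A / c) = 2 * d * A * δ / c := by ring
        linarith
      have e : 4 * d * A * δ / c + 2 * d * A * δ / c = 6 * d * A * δ / c := by ring
      linarith
    have h6 : 0 ≤ 6 * d * A * δ / c := by positivity
    calc volume W ≤ volume {x ∈ D | F x - m ≤ 6 * d * A * δ / c} := measure_mono hsub
      _ ≤ ENNReal.ofReal ((2 * Real.sqrt (2 * (6 * d * A * δ / c) / c)) ^ d) := hvolcube _ h6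
      _ = ENNReal.ofReal ((2 * Real.sqrt (12 * d * A * δ) / c) ^ d) := by
          congr 2
          have e1 : 2 * (6 * d * A * δ / c) / c = (12 * d * A * δ) / c ^ 2 := by field_simp; ring
          rw [e1, Real.sqrt_div (by positivity) (c ^ 2), Real.sqrt_sq hc.le]
          ring
      _ ≤ _ := ENNReal.ofReal_le_ofReal (le_add_of_nonneg_right hT2)
  · -- CASE 2: `s ≥ 4dAδ/c`: the homothety argument
    have hs0 : 0 < s := lt_of_lt_of_le (by positivity) hsmall
    -- if the window is empty there is nothing to prove
    rcases Set.eq_empty_or_nonempty W with hW0 | hWne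
    · rw [hW0, measure_empty]; exact bot_le
    obtain ⟨x₀, hx₀D, hx₀1, _⟩ := hWne
    have hsR : s ≤ A / 2 * R ^ 2 := by
      have h1 := hup x₀ hx₀D
      have h2 : ‖x₀ - xs‖ ≤ R := by
        have := hDR hx₀D; rwa [mem_closedBall, dist_eq_norm] at this
      have h3 : ‖x₀ - xs‖ ^ 2 ≤ R ^ 2 := pow_le_pow_left₀ (norm_nonneg _) h2 2
      have h4 : A / 2 * ‖x₀ - xs‖ ^ 2 ≤ A / 2 * R ^ 2 := mul_le_mul_of_nonneg_left h3 (by positivity)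
      rw [hs]; linarith
    set θ := 2 * A * δ / (c * s) with hθ
    have hθ0 : 0 < θ := by rw [hθ]; positivity
    have hθs : θ * s = 2 * A * δ / c := by rw [hθ]; field_simp
    have hdθ : d * θ ≤ 1 / 2 := by
      have h1 : 4 * d * A * δ ≤ s * c := by rwa [div_le_iff₀ hc] at hsmall
      rw [hθ, mul_div_assoc', div_le_iff₀ (by positivity)]
      linarith
    have hθ1 : θ ≤ 1 / 2 := by
      have : θ ≤ d * θ := le_mul_of_one_le_left hθ0.le hd1
      linarith
    set t := Real.sqrt (1 - θ) with ht
    have h1θ : 0 ≤ 1 - θ := by linarith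
    have ht2 : t ^ 2 = 1 - θ := by rw [ht, Real.sq_sqrt h1θ]
    have ht0 : 0 < t := by rw [ht]; exact Real.sqrt_pos.2 (by linarith)
    have ht1 : t ≤ 1 := by
      rw [ht]
      calc Real.sqrt (1 - θ) ≤ Real.sqrt 1 := Real.sqrt_le_sqrt (by linarith)
        _ = 1 := Real.sqrt_one
    -- the sublevel set `K` and its properties
    set K := {x ∈ D | F x ≤ β - δ} with hK
    have hKm : MeasurableSet K := hDm.inter (hFm measurableSet_Iic)
    -- (a) the shrunk window lies in `K`
    have hWK : AffineMap.homothety xs t '' W ⊆ K := by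
      rintro _ ⟨x, ⟨hxD, hx1, hx2⟩, rfl⟩
      refine ⟨homothety_mem_of_convex hDc hxs hxD ht0.le ht1, ?_⟩
      have hdist : 2 * s / A ≤ ‖x - xs‖ ^ 2 := by
        rw [div_le_iff₀ hA]
        have h1 := hup x hxD
        have h2 : s < F x - m := by rw [hs]; linarith
        nlinarith
      have hg := hgrow x hxD t ht0.le ht1
      have hkey : 2 * δ ≤ c / 2 * (1 - t ^ 2) * ‖x - xs‖ ^ 2 := by
        rw [ht2, show (1 : ℝ) - (1 - θ) = θ by ring]
        have h1 : c / 2 * θ * (2 * s / A) ≤ c / 2 * θ * ‖x - xs‖ ^ 2 := mul_le_mul_of_nonneg_left hdist (by positivity)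
        have e : c / 2 * θ * (2 * s / A) = 2 * δ := by
          calc c / 2 * θ * (2 * s / A) = (θ * s) * (c / A) := by ring
            _ = 2 * A * δ / c * (c / A) := by rw [hθs]
            _ = 2 * δ := by
                rw [div_mul_div_comm, show 2 * A * δ * c = (2 * δ) * (c * A) by ring]
                exact mul_div_cancel_right₀ _ (by positivity)
        linarith
      show F (AffineMap.homothety xs t x) ≤ β - δ
      linarith
    -- (b) the shrunk `K` lies in `K`
    have hKK : AffineMap.homothety xs t '' K ⊆ K := by
      rintro _ ⟨x, ⟨hxD, hxK⟩, rfl⟩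
      refine ⟨homothety_mem_of_convex hDc hxs hxD ht0.le ht1, ?_⟩
      have hg := hgrow x hxD t ht0.le ht1
      have h0 : 0 ≤ c / 2 * (1 - t ^ 2) * ‖x - xs‖ ^ 2 := by
        have : 0 ≤ 1 - t ^ 2 := by rw [ht2]; linarith
        positivity
      show F (AffineMap.homothety xs t x) ≤ β - δ
      have : F x ≤ β - δ := hxK
      linarith
    -- (c) the two images are disjoint (the homothety is injective and `W ∩ K = ∅`)
    have hinj : Function.Injective (AffineMap.homothety xs t) := by
      intro x y hxy
      have h1 : xs + t • (x - xs) = xs + t • (y - xs) := by rw [← homothety_eq_add_smul, ← homothety_eq_add_smul, hxy]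
      have h2 : t • (x - xs) = t • (y - xs) := add_left_cancel h1
      have h3 : x - xs = y - xs := smul_right_injective (ι → ℝ) ht0.ne' h2
      exact sub_left_injective h3
    have hdisjWK : Disjoint W K := by
      rw [Set.disjoint_left]
      rintro x ⟨-, hx1, -⟩ ⟨-, hxK⟩
      have : F x ≤ β - δ := hxK
      linarith
    have hdisj : Disjoint (AffineMap.homothety xs t '' W) (AffineMap.homothety xs t '' K) :=
      (Set.disjoint_image_iff hinj).2 hdisjWK
    -- (d) measurability of the image of `K`: it is the preimage under the inverse homothety
    have himK : AffineMap.homothety xs t '' K = (fun y => xs + t⁻¹ • (y - xs)) ⁻¹' K := by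
      ext y
      constructor
      · rintro ⟨x, hx, rfl⟩
        show xs + t⁻¹ • (AffineMap.homothety xs t x - xs) ∈ K
        rw [homothety_eq_add_smul, add_sub_cancel_left, smul_smul, inv_mul_cancel₀ ht0.ne', one_smul, add_sub_cancel]
        exact hx
      · intro hy
        refine ⟨xs + t⁻¹ • (y - xs), hy, ?_⟩
        rw [homothety_eq_add_smul, add_sub_cancel_left, smul_smul, mul_inv_cancel₀ ht0.ne', one_smul, add_sub_cancel]
    have hKim : MeasurableSet (AffineMap.homothety xs t '' K) := by
      rw [himK]
      have hmf : Measurable (fun y : ι → ℝ => xs + t⁻¹ • (y - xs)) := by fun_prop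
      exact hmf hKm
    -- (e) volumes: `t^d (vol W + vol K) ≤ vol K`
    have hfr : Module.finrank ℝ (ι → ℝ) = d := by rw [hd_def]; exact Module.finrank_fintype_fun_eq_card ℝ
    have hscale : ∀ S : Set (ι → ℝ), volume (AffineMap.homothety xs t '' S) = ENNReal.ofReal (t ^ d) * volume S := by
      intro S
      rw [MeasureTheory.Measure.addHaar_image_homothety, hfr, abs_of_pos (pow_pos ht0 d)]
    have hunion : volume (AffineMap.homothety xs t '' W) + volume (AffineMap.homothety xs t '' K) ≤ volume K := by
      rw [← measure_union hdisj hKim]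
      exact measure_mono (Set.union_subset hWK hKK)
    rw [hscale W, hscale K] at hunion
    -- finiteness and the cube bound for `K`
    have hKsub : K ⊆ {x ∈ D | F x - m ≤ s} := by
      rintro x ⟨hxD, hxK⟩
      have : F x ≤ β - δ := hxK
      exact ⟨hxD, by rw [hs]; linarith⟩
    have hKvol : volume K ≤ ENNReal.ofReal ((2 * Real.sqrt (2 * s / c)) ^ d) := (measure_mono hKsub).trans (hvolcube s hs0.le)
    have hKfin : volume K ≠ ⊤ := (lt_of_le_of_lt hKvol ENNReal.ofReal_lt_top).ne
    have hWfin : volume W ≠ ⊤ := by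
      have h1 : W ⊆ Metric.closedBall xs R := fun x hx => hDR hx.1
      exact (lt_of_le_of_lt (measure_mono h1) (by rw [Real.volume_pi_closedBall xs hR]; exact ENNReal.ofReal_lt_top)).ne
    -- pass to real numbers
    set vW := (volume W).toReal with hvW
    set vK := (volume K).toReal with hvK
    have htd : 0 < t ^ d := pow_pos ht0 d
    have hreal : t ^ d * vW + t ^ d * vK ≤ vK := by
      have h1 := ENNReal.toReal_mono hKfin hunion
      rw [ENNReal.toReal_add (ENNReal.mul_ne_top ENNReal.ofReal_ne_top hWfin) (ENNReal.mul_ne_top ENNReal.ofReal_ne_top hKfin),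
        ENNReal.toReal_mul, ENNReal.toReal_mul, ENNReal.toReal_ofReal htd.le] at h1
      exact h1
    have hvK0 : 0 ≤ vK := ENNReal.toReal_nonneg
    have hvW0 : 0 ≤ vW := ENNReal.toReal_nonneg
    -- `t^d ≥ 1 − dθ ≥ 1/2`
    have htd_ge : 1 - d * θ ≤ t ^ d := by
      have h2 : 1 - θ ≤ t := by
        rw [ht]
        calc 1 - θ = Real.sqrt (1 - θ) * Real.sqrt (1 - θ) := (Real.mul_self_sqrt h1θ).symm
          _ ≤ Real.sqrt (1 - θ) * 1 := by
              refine mul_le_mul_of_nonneg_left ?_ (Real.sqrt_nonneg _)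
              calc Real.sqrt (1 - θ) ≤ Real.sqrt 1 := Real.sqrt_le_sqrt (by linarith)
                _ = 1 := Real.sqrt_one
          _ = Real.sqrt (1 - θ) := mul_one _
      have h1 : (1 - θ) ^ d ≤ t ^ d := pow_le_pow_left₀ h1θ h2 d
      exact (one_sub_mul_le_one_sub_pow (by linarith) d).trans h1
    have hvW_le : vW ≤ 2 * d * θ * vK := by
      have h1 : t ^ d * vW ≤ (1 - t ^ d) * vK := by
        have e : (1 - t ^ d) * vK = vK - t ^ d * vK := by ring
        rw [e]; linarith
      have h2 : (1 - t ^ d) * vK ≤ d * θ * vK := mul_le_mul_of_nonneg_right (by linarith) hvK0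
      have h3 : (1 : ℝ) / 2 ≤ t ^ d := by linarith
      have h4 : vW * t ^ d ≤ d * θ * vK := by rw [mul_comm]; exact h1.trans h2
      have h5 : vW ≤ d * θ * vK / t ^ d := (le_div_iff₀ htd).2 h4
      have h6 : d * θ * vK / t ^ d ≤ 2 * d * θ * vK := by
        rw [div_le_iff₀ htd]
        have h7 : 0 ≤ d * θ * vK := by positivity
        have h8 : d * θ * vK * 1 ≤ d * θ * vK * (2 * t ^ d) := mul_le_mul_of_nonneg_left (by linarith) h7
        linarith
      exact h5.trans h6
    -- `vK ≤ (2√(2s/c))^d = (2√(2/c))^d · s · (√s)^{d−2}`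
    have hvK_le : vK ≤ (2 * Real.sqrt (2 * s / c)) ^ d := by
      have := ENNReal.toReal_mono ENNReal.ofReal_ne_top hKvol
      rwa [ENNReal.toReal_ofReal (by positivity)] at this
    have e1 : (2 * Real.sqrt (2 * s / c)) ^ d = (2 * Real.sqrt (2 / c)) ^ d * (s * Real.sqrt s ^ (d - 2)) := by
      have e2 : Real.sqrt (2 * s / c) = Real.sqrt (2 / c) * Real.sqrt s := by
        rw [show 2 * s / c = (2 / c) * s by ring, Real.sqrt_mul (by positivity)]
      have e3 : Real.sqrt s ^ d = s * Real.sqrt s ^ (d - 2) := by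
        obtain ⟨k, hk⟩ : ∃ k, d = k + 2 := ⟨d - 2, by omega⟩
        rw [hk, Nat.add_sub_cancel, pow_add, Real.sq_sqrt hs0.le]; ring
      rw [e2, ← mul_assoc, mul_pow, e3]
    have hsqrt_s : Real.sqrt s ≤ R * Real.sqrt (A / 2) := by
      have h1 : Real.sqrt s ≤ Real.sqrt (A / 2 * R ^ 2) := Real.sqrt_le_sqrt hsR
      rw [Real.sqrt_mul (by positivity), Real.sqrt_sq hR] at h1
      linarith [h1]
    have hpow : Real.sqrt s ^ (d - 2) ≤ (R * Real.sqrt (A / 2)) ^ (d - 2) := pow_le_pow_left₀ (Real.sqrt_nonneg _) hsqrt_s _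
    have hvW_final : vW ≤ (4 * d * A * δ / c) * (2 * Real.sqrt (2 / c)) ^ d * (R * Real.sqrt (A / 2)) ^ (d - 2) := by
      have hP : 0 ≤ (2 * Real.sqrt (2 / c)) ^ d := by positivity
      calc vW ≤ 2 * d * θ * vK := hvW_le
        _ ≤ 2 * d * θ * ((2 * Real.sqrt (2 / c)) ^ d * (s * Real.sqrt s ^ (d - 2))) := by
            rw [← e1]; exact mul_le_mul_of_nonneg_left hvK_le (by positivity)
        _ = (2 * d * (θ * s)) * (2 * Real.sqrt (2 / c)) ^ d * Real.sqrt s ^ (d - 2) := by ring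
        _ = (4 * d * A * δ / c) * (2 * Real.sqrt (2 / c)) ^ d * Real.sqrt s ^ (d - 2) := by rw [hθs]; ring
        _ ≤ (4 * d * A * δ / c) * (2 * Real.sqrt (2 / c)) ^ d * (R * Real.sqrt (A / 2)) ^ (d - 2) :=
            mul_le_mul_of_nonneg_left hpow (by positivity)
    -- conclude
    have hvolW : volume W = ENNReal.ofReal vW := (ENNReal.ofReal_toReal hWfin).symm
    rw [hvolW]
    exact ENNReal.ofReal_le_ofReal (by linarith [hvW_final, hT1])

/-! ## §4 The three steps combined: grid points in a thin level window -/

/-- **Grid points in a thin level window** (cube packing ∘ Lipschitz thickening ∘ volume of the window).  Let `P` be a finite `h`-separated set of points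
(e.g. points of a grid of spacing `h`, `dist_grid_ge`) lying in `D` and in the level window `|F − β| ≤ δ`.  Let `D ⊆ D′` with `thickening (h/2) D ⊆ D′`,
`D′` convex, measurable, contained in `closedBall x⋆ R`, `x⋆ ∈ D′`; let `F` be measurable, `L`-Lipschitz on `D′` (sup-norm distance), growing strongly along
rays from `x⋆` and at most quadratically on `D′` (constants `0 < c ≤ A`), `d = |ι| ≥ 2`.  Then, with `δ′ := 2δ + (L+1)·h`,
`#P · h^d ≤ (2√(12dAδ′)/c)^d + (4dAδ′/c)·(2√(2/c))^d·(R√(A/2))^{d−2}`. [folklore] -/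
theorem card_mul_pow_le_of_levelWindow {D D' : Set (ι → ℝ)} (hDD' : D ⊆ D') {h : ℝ} (hh : 0 < h)
    (hthick : Metric.thickening (h / 2) D ⊆ D') (hD'c : Convex ℝ D') (hD'm : MeasurableSet D')
    {F : (ι → ℝ) → ℝ} (hFm : Measurable F) {xs : ι → ℝ} (hxs : xs ∈ D')
    {c A R L : ℝ} (hc : 0 < c) (hcA : c ≤ A) (hR : 0 ≤ R) (hL0 : 0 ≤ L) (hDR : D' ⊆ Metric.closedBall xs R) (hd : 2 ≤ Fintype.card ι)
    (hLip : ∀ x ∈ D', ∀ y ∈ D', |F x - F y| ≤ L * dist x y)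
    (hgrow : ∀ x ∈ D', ∀ t : ℝ, 0 ≤ t → t ≤ 1 → F (AffineMap.homothety xs t x) ≤ F x - c / 2 * (1 - t ^ 2) * ‖x - xs‖ ^ 2)
    (hup : ∀ x ∈ D', F x - F xs ≤ A / 2 * ‖x - xs‖ ^ 2)
    (β δ : ℝ) (hδ : 0 ≤ δ) (P : Finset (ι → ℝ)) (hsep : ∀ p ∈ P, ∀ q ∈ P, p ≠ q → h ≤ dist p q)
    (hP : ∀ p ∈ P, p ∈ D ∧ |F p - β| ≤ δ) :
    (P.card : ℝ) * h ^ Fintype.card ι ≤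
      (2 * Real.sqrt (12 * Fintype.card ι * A * (2 * δ + (L + 1) * h)) / c) ^ Fintype.card ι +
        (4 * Fintype.card ι * A * (2 * δ + (L + 1) * h) / c) * (2 * Real.sqrt (2 / c)) ^ Fintype.card ι *
          (R * Real.sqrt (A / 2)) ^ (Fintype.card ι - 2) := by
  set d := Fintype.card ι with hd_def
  set δ' := 2 * δ + (L + 1) * h with hδ'
  have hδ'0 : 0 < δ' := by rw [hδ']; positivity
  have hA : 0 < A := hc.trans_le hcA
  -- cube packing
  have h1 := card_mul_pow_le_volume_thickening hh P {x ∈ D | |F x - β| ≤ δ} (fun p hp => hP p hp) hsep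
  -- Lipschitz thickening
  have h2 : Metric.thickening (h / 2) {x ∈ D | |F x - β| ≤ δ} ⊆ {x ∈ D' | |F x - β| ≤ δ + L * (h / 2)} :=
    thickening_levelWindow_subset hthick hDD' hL0 hLip
  -- into the half-open window of half-width `δ′`
  have h3 : {x ∈ D' | |F x - β| ≤ δ + L * (h / 2)} ⊆ {x ∈ D' | β - δ' < F x ∧ F x ≤ β + δ'} := by
    rintro x ⟨hxD, hxF⟩
    have hab := abs_le.1 hxF
    have hLh : 0 ≤ L * h := by positivity
    refine ⟨hxD, ?_, ?_⟩
    · rw [hδ']; nlinarith [hab.1, hh, hδ, hLh]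
    · rw [hδ']; nlinarith [hab.2, hh, hδ, hLh]
  -- the volume bound
  have h4 := volume_levelWindow_le hD'c hD'm hFm hxs hc hcA hR hDR hd hgrow hup β δ' hδ'0
  have hB : 0 ≤ (2 * Real.sqrt (12 * d * A * δ') / c) ^ d +
      (4 * d * A * δ' / c) * (2 * Real.sqrt (2 / c)) ^ d * (R * Real.sqrt (A / 2)) ^ (d - 2) := by positivity
  have h5 : (P.card : ℝ≥0∞) * ENNReal.ofReal (h ^ d) ≤ ENNReal.ofReal ((2 * Real.sqrt (12 * d * A * δ') / c) ^ d +
      (4 * d * A * δ' / c) * (2 * Real.sqrt (2 / c)) ^ d * (R * Real.sqrt (A / 2)) ^ (d - 2)) :=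
    h1.trans ((measure_mono (h2.trans h3)).trans h4)
  have e : (P.card : ℝ≥0∞) * ENNReal.ofReal (h ^ d) = ENNReal.ofReal ((P.card : ℝ) * h ^ d) := by
    rw [ENNReal.ofReal_mul (by positivity), ENNReal.ofReal_natCast]
  rw [e] at h5
  exact (ENNReal.ofReal_le_ofReal_iff hB).1 h5

end Summit.HubbardSuperconductivity.HubbardSuperconductivity.Theorems.ThinLevelSet

end
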